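import Summits.CriticalPhenomena.Ising3DConformalLimit.Theses.SubPtolemyInterlacing
import Summits.CriticalPhenomena.Ising3DConformalLimit.Theorems.SubPtolemyInterlacingInterlacingBalancedSuffices
import HarnessLib

/-!
# Route `SubPtolemyInterlacing` — TURNKEY rev-3 deciding theorem (lead c12 of the aside stmt-CriticalPhenomena-15702)

Planner/operator artefact, not a proof obligation. Since the judge-repair of 2026-08-17T08:58Z the load-bearing four-point
item of the route is stmt-CriticalPhenomena-18014 `InterlacingEventualBalanced` (signature below, VERBATIM from the ledger),
while the route file rev 2 still renders `closes (hI : Interlacing) …` on the ASIDE stmt-CriticalPhenomena-15702 — which is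
why the HONEST re-audit keeps seating line leads on 15702 (thirteen so far), each ending `blocked-on 18014` in one cycle.

This file is the rev-3 `--closes-file` body: with the decl `InterlacingEventualBalanced` rendered from item 18014 (here a
local `def` with the identical term), `closes` is two lines over the LANDED transfer lemma
`Sketch.transfer_ising3D_of_balanced` (p140149). It elaborates sorry-free against the current tree.
-/

namespace Summit.CriticalPhenomena.Ising3DConformalLimit.Cruxes.Interlacing.RouteRev3

open Summit.CriticalPhenomena.Ising3DConformalLimit.Theses.SubPtolemyInterlacing
open Summit.CriticalPhenomena.Ising3DConformalLimit.Cruxes.Interlacing.Sketch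

/-- Item stmt-CriticalPhenomena-18014, signature verbatim (the decl the route file rev 3 should render). -/
def InterlacingEventualBalanced : Prop :=
  ∃ N₀ : ℕ, ∀ N : ℕ, N₀ ≤ N → 1 ≤ N → Literature.Probability.LatticeModels.criticalCorr 3 4 ![Pi.single 0 ((0 : ℕ) : ℤ), Pi.single 0 ((2 * N : ℕ) : ℤ), Pi.single 0 ((3 * N : ℕ) : ℤ), Pi.single 0 ((6 * N : ℕ) : ℤ)] * (Literature.Probability.LatticeModels.criticalCorr 3 2 ![Pi.single 0 ((0 : ℕ) : ℤ), Pi.single 0 ((3 * N : ℕ) : ℤ)] * Literature.Probability.LatticeModels.criticalCorr 3 2 ![Pi.single 0 ((2 * N : ℕ) : ℤ), Pi.single 0 ((6 * N : ℕ) : ℤ)]) ≤ Literature.Probability.LatticeModels.criticalCorr 3 2 ![Pi.single 0 ((0 : ℕ) : ℤ), Pi.single 0 ((2 * N : ℕ) : ℤ)] * Literature.Probability.LatticeModels.criticalCorr 3 2 ![Pi.single 0 ((3 * N : ℕ) : ℤ), Pi.single 0 ((6 * N : ℕ) : ℤ)] * (Literature.Probability.LatticeModels.criticalCorr 3 2 ![Pi.single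 0 ((0 : ℕ) : ℤ), Pi.single 0 ((6 * N : ℕ) : ℤ)] * Literature.Probability.LatticeModels.criticalCorr 3 2 ![Pi.single 0 ((2 * N : ℕ) : ℤ), Pi.single 0 ((3 * N : ℕ) : ℤ)])

/-- The rev-3 deciding theorem: `InterlacingEventualBalanced → SubPtolemyFloor → MoebiusLimit → Ising3DConformalLimit`
(the fourth rev-2 hypothesis `InterlacingForcesU4` is closed, p-proved, and not needed as a hypothesis). -/
theorem closes (hB : InterlacingEventualBalanced) (hF : SubPtolemyFloor) (hML : MoebiusLimit) :
    _root_.Ising3DConformalLimit := by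
  obtain ⟨N₀, h⟩ := hB
  exact transfer_ising3D_of_balanced N₀ h hF hML

/-- Sanity: the aside implies the new crux (so rev 3 is a pure weakening of rev 2's first hypothesis). -/
theorem interlacingEventualBalanced_of_interlacing (hI : Interlacing) : InterlacingEventualBalanced :=
  ⟨1, fun N _ hN => Summit.CriticalPhenomena.Ising3DConformalLimit.Theorems.interlacingForcesU4_interlacing_balanced hI N hN⟩

end Summit.CriticalPhenomena.Ising3DConformalLimit.Cruxes.Interlacing.RouteRev3
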